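import Summits.CriticalPhenomena.Ising3DConformalLimit.Theorems.InversionUpgradeNormalised.Negative.DownwardRigidity
import Summits.CriticalPhenomena.Ising3DConformalLimit.Theorems.InversionUpgradeNormalised.Negative.ReflectionPositiveOrders

/-!
# `InversionUpgradeNormalised` (item stmt-CriticalPhenomena-1982): downward rigidity, Gaussian instance at orders `(2,4)`

Standing crux disprover, cycle 3. Instance of `downward_rigidity` (`DownwardRigidity.lean`) on
tree objects: a reflection-positive (one axis), translation- and reflection-invariant family on
`ℝ³` with `S₀ = 1` whose four-point function is the Wick function `wick Δ` of `twoPt Δ`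
(`Literature.Barriers.CriticalPhenomena.ScaleCovarianceNotMoebius`, `Δ > 0`) has
`S₂ = γ · twoPt Δ` on all non-coincident pairs, `γ² ≤ 1` (`wick_downward_two`,
`exists_gamma_two_point_of_wick_four`). The OS clustering input is explicit: internal `twoPt`
factors do not move under the time translation (`twoPt_reflect_shift`, `twoPt_shift`) and cross factors
die (`tendsto_twoPt_cross`). The order-`(4,8)` instance, which yields inversion covariance of `S₄`,
is `DownwardRigidityWickEight.lean`.
-/

noncomputable section

namespace Summit.CriticalPhenomena.Ising3DConformalLimit.InversionUpgradeNormalisedNegative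

open Literature.Probability.LatticeModels Literature.Barriers.CriticalPhenomena
open Literature.MathematicalPhysics.QuantumFieldTheory
open Filter Set Function ScaleNotMoebius EuclideanGeometry
open scoped Topology RealInnerProductSpace

section Gaussian

variable {τ : Fin 3}

local notation "E³" => EuclideanSpace ℝ (Fin 3)

/-- The two-point half-space configuration `(p, q)`. [folklore] -/
def cfg2 (p q : E³) (hp : 0 < p τ) (hq : 0 < q τ) (hpq : p ≠ q) : HalfSpaceConfig 3 τ where
  n := 2
  pts := ![p, q]
  injective := by
    intro i j hij
    fin_cases i <;> fin_cases j
    · rfl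
    · exact absurd hij hpq
    · exact absurd hij.symm hpq
    · rfl
  pos := fun i => by fin_cases i <;> simpa

/-- `Fin.append` of two pairs as a vector literal. [folklore] -/
theorem fin_append_two_two {α : Type*} (f g : Fin 2 → α) :
    Fin.append f g = ![f 0, f 1, g 0, g 1] := by
  funext i
  fin_cases i <;> rfl

/-- The OS entry of two (time-shifted, `L ≥ 0`) two-point configurations is a value of `S₄`. [folklore] -/
theorem osPointKernel_cfg2 (S : CorrFamily 3) {p q u v : E³} (hp : 0 < p τ) (hq : 0 < q τ)
    (hpq : p ≠ q) (hu : 0 < u τ) (hv : 0 < v τ) (huv : u ≠ v) {L : ℝ} (hL : 0 ≤ L) :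
    osPointKernel S ((cfg2 p q hp hq hpq).timeShift L) ((cfg2 u v hu hv huv).timeShift L) =
      S 4 ![axisReflection τ (p + EuclideanSpace.single τ L),
        axisReflection τ (q + EuclideanSpace.single τ L),
        u + EuclideanSpace.single τ L, v + EuclideanSpace.single τ L] := by
  rw [HalfSpaceConfig.timeShift_of_nonneg hL, HalfSpaceConfig.timeShift_of_nonneg hL]
  show S 4 (Fin.append (fun i => axisReflection τ (![p, q] i + EuclideanSpace.single τ L))
      (fun i => ![u, v] i + EuclideanSpace.single τ L)) = _
  rw [fin_append_two_two]
  rfl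

/-- The argument of that `S₄` is non-coincident. [folklore] -/
theorem cfg2_arg_injective {p q u v : E³} (hp : 0 < p τ) (hq : 0 < q τ)
    (hpq : p ≠ q) (hu : 0 < u τ) (hv : 0 < v τ) (huv : u ≠ v) {L : ℝ} (hL : 0 ≤ L) :
    Function.Injective ![axisReflection τ (p + EuclideanSpace.single τ L),
        axisReflection τ (q + EuclideanSpace.single τ L),
        u + EuclideanSpace.single τ L, v + EuclideanSpace.single τ L] := by
  have h := osPointKernel_arg_injective ((cfg2 p q hp hq hpq).timeShift L) ((cfg2 u v hu hv huv).timeShift L)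
  rw [HalfSpaceConfig.timeShift_of_nonneg hL, HalfSpaceConfig.timeShift_of_nonneg hL] at h
  change Function.Injective (Fin.append
      (fun i => axisReflection τ (![p, q] i + EuclideanSpace.single τ L))
      (fun i => ![u, v] i + EuclideanSpace.single τ L)) at h
  rw [fin_append_two_two] at h
  simpa using h

/-- Internal factors do not move: `twoPt Δ (θ(x+Le)) (θ(y+Le)) = twoPt Δ x y`. [folklore] -/
theorem twoPt_reflect_shift (Δ : ℝ) (x y : E³) (L : ℝ) :
    twoPt Δ (axisReflection τ (x + EuclideanSpace.single τ L))
      (axisReflection τ (y + EuclideanSpace.single τ L)) = twoPt Δ x y := by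
  rw [twoPt_map, twoPt_add]

/-- Internal factors do not move: `twoPt Δ (x+Le) (y+Le) = twoPt Δ x y`. [folklore] -/
theorem twoPt_shift (Δ : ℝ) (x y : E³) (L : ℝ) :
    twoPt Δ (x + EuclideanSpace.single τ L) (y + EuclideanSpace.single τ L) = twoPt Δ x y :=
  twoPt_add Δ x y _

/-- **Cross factors die**: `twoPt Δ (θ(x + Le_τ)) (y + Le_τ) → 0` as `L → ∞` (`Δ > 0`): the two
points separate by at least `2L - ‖θx - y‖`. [folklore] -/
theorem tendsto_twoPt_cross {Δ : ℝ} (hΔ : 0 < Δ) (x y : E³) :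
    Tendsto (fun L : ℝ => twoPt Δ (axisReflection τ (x + EuclideanSpace.single τ L))
      (y + EuclideanSpace.single τ L)) atTop (𝓝 0) := by
  -- lower bound on the separation
  have hsep : ∀ L : ℝ, 2 * L - ‖axisReflection τ x - y‖ ≤
      ‖axisReflection τ (x + EuclideanSpace.single τ L) - (y + EuclideanSpace.single τ L)‖ := by
    intro L
    rw [axisReflection_add_single]
    have e : axisReflection τ x - EuclideanSpace.single τ L - (y + EuclideanSpace.single τ L)
        = (axisReflection τ x - y) - (2 : ℝ) • EuclideanSpace.single τ L := by
      rw [two_smul]; abel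
    rw [e]
    have h1 := norm_sub_norm_le ((2 : ℝ) • EuclideanSpace.single τ L) (axisReflection τ x - y)
    have h2 : ‖(2 : ℝ) • EuclideanSpace.single τ L‖ = 2 * |L| := by
      rw [norm_smul, PiLp.norm_single, Real.norm_eq_abs, Real.norm_eq_abs, abs_of_pos two_pos]
    have h3 : L ≤ |L| := le_abs_self L
    have h4 : ‖(2 : ℝ) • EuclideanSpace.single τ L - (axisReflection τ x - y)‖ =
        ‖axisReflection τ x - y - (2 : ℝ) • EuclideanSpace.single τ L‖ := norm_sub_rev _ _
    linarith
  have hnorm : Tendsto (fun L : ℝ => ‖axisReflection τ (x + EuclideanSpace.single τ L)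
      - (y + EuclideanSpace.single τ L)‖) atTop atTop := by
    refine tendsto_atTop_mono hsep ?_
    have : Tendsto (fun L : ℝ => 2 * L) atTop atTop := Tendsto.const_mul_atTop two_pos tendsto_id
    exact tendsto_atTop_add_const_right atTop (-‖axisReflection τ x - y‖) this
  have h := (tendsto_rpow_neg_atTop (by linarith : 0 < 2 * Δ)).comp hnorm
  simpa [twoPt, Function.comp_def] using h

/-- **The Gaussian OS clustering at orders `(2,4)`.** If `S₄ = wick Δ` on non-coincident
configurations, then `K(a_L, b_L) → twoPt(a) · twoPt(b)` for two-point configurations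
`a = (p,q)`, `b = (u,v)`. [folklore] -/
theorem tendsto_osPointKernel_cfg2 {S : CorrFamily 3} {Δ : ℝ} (hΔ : 0 < Δ)
    (h4 : ∀ x : Fin 4 → E³, Function.Injective x → S 4 x = wick Δ x)
    {p q u v : E³} (hp : 0 < p τ) (hq : 0 < q τ) (hpq : p ≠ q) (hu : 0 < u τ) (hv : 0 < v τ) (huv : u ≠ v) :
    Tendsto (fun L => osPointKernel S ((cfg2 p q hp hq hpq).timeShift L) ((cfg2 u v hu hv huv).timeShift L))
      atTop (𝓝 (twoPt Δ p q * twoPt Δ u v)) := by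
  have hev : ∀ᶠ L in atTop,
      twoPt Δ p q * twoPt Δ u v
        + twoPt Δ (axisReflection τ (p + EuclideanSpace.single τ L)) (u + EuclideanSpace.single τ L)
          * twoPt Δ (axisReflection τ (q + EuclideanSpace.single τ L)) (v + EuclideanSpace.single τ L)
        + twoPt Δ (axisReflection τ (p + EuclideanSpace.single τ L)) (v + EuclideanSpace.single τ L)
          * twoPt Δ (axisReflection τ (q + EuclideanSpace.single τ L)) (u + EuclideanSpace.single τ L)
      = osPointKernel S ((cfg2 p q hp hq hpq).timeShift L) ((cfg2 u v hu hv huv).timeShift L) := by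
    filter_upwards [eventually_ge_atTop (0 : ℝ)] with L hL
    rw [osPointKernel_cfg2 S hp hq hpq hu hv huv hL, h4 _ (cfg2_arg_injective hp hq hpq hu hv huv hL)]
    simp only [wick, Matrix.cons_val_zero, Matrix.cons_val_one, Matrix.head_cons, Matrix.cons_val_two,
      Matrix.cons_val_three, Matrix.tail_cons, twoPt_reflect_shift, twoPt_shift]
  have h := ((tendsto_const_nhds (x := twoPt Δ p q * twoPt Δ u v)).add
    ((tendsto_twoPt_cross hΔ p u (τ := τ)).mul (tendsto_twoPt_cross hΔ q v (τ := τ)))).add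
    ((tendsto_twoPt_cross hΔ p v (τ := τ)).mul (tendsto_twoPt_cross hΔ q u (τ := τ)))
  simp only [mul_zero, add_zero] at h
  exact h.congr' hev

/-- Symmetrised version. [folklore] -/
theorem tendsto_osSym_cfg2 {S : CorrFamily 3} {Δ : ℝ} (hΔ : 0 < Δ)
    (h4 : ∀ x : Fin 4 → E³, Function.Injective x → S 4 x = wick Δ x)
    {p q u v : E³} (hp : 0 < p τ) (hq : 0 < q τ) (hpq : p ≠ q) (hu : 0 < u τ) (hv : 0 < v τ) (huv : u ≠ v) :
    Tendsto (fun L => osSym S ((cfg2 p q hp hq hpq).timeShift L) ((cfg2 u v hu hv huv).timeShift L))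
      atTop (𝓝 (twoPt Δ p q * twoPt Δ u v)) := by
  have h := ((tendsto_osPointKernel_cfg2 hΔ h4 hp hq hpq hu hv huv (τ := τ)).add
    (tendsto_osPointKernel_cfg2 hΔ h4 hu hv huv hp hq hpq (τ := τ))).div_const 2
  have e : (twoPt Δ p q * twoPt Δ u v + twoPt Δ u v * twoPt Δ p q) / 2 = twoPt Δ p q * twoPt Δ u v := by
    ring
  rw [e] at h
  exact h

/-- **DOWNWARD RIGIDITY, Gaussian instance at orders `(2,4)`.** A reflection-positive (along one
axis), translation- and reflection-invariant family on `ℝ³` with `S₀ = 1` whose four-point function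
is the Wick function `wick Δ` of `twoPt Δ` (`Δ > 0`) has `S₂(p,q)/twoPt Δ p q` CONSTANT over pairs in
the half-space. [folklore] -/
theorem wick_downward_two {S : CorrFamily 3} {Δ : ℝ} (hΔ : 0 < Δ)
    (hRP : IsReflectionPositiveAlong τ S) (hT : IsTranslationInvariant S)
    (hR : IsReflectionInvariantAlong τ S) (h0 : ∀ x, S 0 x = 1)
    (h4 : ∀ x : Fin 4 → E³, Function.Injective x → S 4 x = wick Δ x)
    {p q u v : E³} (hp : 0 < p τ) (hq : 0 < q τ) (hpq : p ≠ q) (hu : 0 < u τ) (hv : 0 < v τ) (huv : u ≠ v) :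
    S 2 ![p, q] / twoPt Δ p q = S 2 ![u, v] / twoPt Δ u v := by
  have key := downward_rigidity hRP (osPointKernel_empty_empty S h0)
    (cfg2 p q hp hq hpq) (cfg2 u v hu hv huv) (twoPt_pos Δ hpq).ne' (twoPt_pos Δ huv).ne'
    (fun L hL => osSym_empty_timeShift S hT hR _ hL) (fun L hL => osSym_empty_timeShift S hT hR _ hL)
    (by simpa [sq] using tendsto_osPointKernel_cfg2 hΔ h4 hp hq hpq hp hq hpq (τ := τ))
    (tendsto_osSym_cfg2 hΔ h4 hp hq hpq hu hv huv)
    (by simpa [sq] using tendsto_osPointKernel_cfg2 hΔ h4 hu hv huv hu hv huv (τ := τ))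
  rwa [osSym_empty S hR, osSym_empty S hR] at key

/-- … and the constant has modulus at most `1`. [folklore] -/
theorem wick_ratio_sq_le_one {S : CorrFamily 3} {Δ : ℝ} (hΔ : 0 < Δ)
    (hRP : IsReflectionPositiveAlong τ S) (hT : IsTranslationInvariant S)
    (hR : IsReflectionInvariantAlong τ S) (h0 : ∀ x, S 0 x = 1)
    (h4 : ∀ x : Fin 4 → E³, Function.Injective x → S 4 x = wick Δ x)
    {p q : E³} (hp : 0 < p τ) (hq : 0 < q τ) (hpq : p ≠ q) :
    (S 2 ![p, q] / twoPt Δ p q) ^ 2 ≤ 1 := by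
  have key := ratio_sq_le_one hRP (osPointKernel_empty_empty S h0) (cfg2 p q hp hq hpq)
    (twoPt_pos Δ hpq).ne' (fun L hL => osSym_empty_timeShift S hT hR _ hL)
    (by simpa [sq] using tendsto_osPointKernel_cfg2 hΔ h4 hp hq hpq hp hq hpq (τ := τ))
  rwa [osSym_empty S hR] at key

/-- **Corollary: `S₂ = γ · twoPt Δ` on ALL non-coincident pairs, `γ ∈ [-1,1]`** (translate any
pair into the half-space). [folklore] -/
theorem exists_gamma_two_point_of_wick_four {S : CorrFamily 3} {Δ : ℝ} (hΔ : 0 < Δ) (τ : Fin 3)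
    (hRP : IsReflectionPositiveAlong τ S) (hT : IsTranslationInvariant S)
    (hR : IsReflectionInvariantAlong τ S) (h0 : ∀ x, S 0 x = 1)
    (h4 : ∀ x : Fin 4 → E³, Function.Injective x → S 4 x = wick Δ x) :
    ∃ γ : ℝ, γ ^ 2 ≤ 1 ∧ ∀ p q : E³, p ≠ q → S 2 ![p, q] = γ * twoPt Δ p q := by
  -- reference pair in the half-space
  set e : E³ := EuclideanSpace.single τ 1 with he
  have he1 : 0 < e τ := by simp [he]
  have he2 : 0 < ((2 : ℝ) • e) τ := by simp [he]
  have hne : e ≠ (2 : ℝ) • e := by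
    intro h
    have := congrArg (fun z : E³ => z τ) h
    simp [he] at this
  refine ⟨S 2 ![e, (2 : ℝ) • e] / twoPt Δ e ((2 : ℝ) • e), wick_ratio_sq_le_one hΔ hRP hT hR h0 h4 he1 he2 hne, ?_⟩
  intro p q hpq
  -- translate (p, q) up by `t e_τ`, `t = 1 + |p τ| + |q τ|`
  set t : ℝ := 1 + |p τ| + |q τ| with ht
  set w : E³ := EuclideanSpace.single τ t with hw
  have hp' : 0 < (p + w) τ := by
    simp only [PiLp.add_apply, hw, PiLp.single_apply, if_true]
    have := neg_abs_le (p τ); have := abs_nonneg (q τ); linarith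
  have hq' : 0 < (q + w) τ := by
    simp only [PiLp.add_apply, hw, PiLp.single_apply, if_true]
    have := neg_abs_le (q τ); have := abs_nonneg (p τ); linarith
  have hpq' : p + w ≠ q + w := fun h => hpq (add_right_cancel h)
  have key := wick_downward_two hΔ hRP hT hR h0 h4 hp' hq' hpq' he1 he2 hne
  have hS : S 2 ![p + w, q + w] = S 2 ![p, q] := by
    have e1 : (fun i => (![p, q] : Fin 2 → E³) i + w) = ![p + w, q + w] := by
      funext i; fin_cases i <;> rfl
    rw [← e1]
    exact hT 2 w ![p, q]
  rw [hS, twoPt_add] at key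
  rw [← key, div_mul_cancel₀ _ (twoPt_pos Δ hpq).ne']

end Gaussian

end Summit.CriticalPhenomena.Ising3DConformalLimit.InversionUpgradeNormalisedNegative

end
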